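import Literature.NumberTheory.Automorphic.CDTTheorem722ThreeFactsProofs
import Literature.NumberTheory.EllipticCurves.IsogenyFrobeniusTraceHoldsProofs
import Literature.NumberTheory.EllipticCurves.CuspFormLFunctionLevelConductorOfCarayolProofs
import Literature.NumberTheory.EllipticCurves.CuspFormLFunctionLevelConductorProofs
import Literature.NumberTheory.EllipticCurves.OggFormulaPotGoodOrdinaryTwoProofs
import Literature.NumberTheory.EllipticCurves.HasseWeilAbelianConductorSwanIndependenceTwoProofs
import Summits.ABC.ABC.Theorems.DefiniteXiFreyModularityStubNineTransfer
import HarnessLib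

/-!
# Stub ideas `stub_threeImpTwo` (S9, BCDT (3) ⇒ (2)) — ideator k1, gen 16: the helper file, merged

Companion of `STUB-IDEAS-stub_threeImpTwo-1.md` (crux `FreyModularity`, stmt-ABC-11340; skeleton
`Lines/Sketch.lean` sha 21576c53, stub :186 = `SigS9` below).  SELF-CONTAINED MERGE of the gen-9
companion (`…_1g9.lean`: currencies, H1–H9) and the gen-15 companion (`…_1g15.lean`: H10–H12),
which are not importable as modules, plus the gen-16 lemmas H13–H16 (the per-call-site residue of
S9).  This file is the candidate body of Plan A's helper Theorems file
`Summits/ABC/ABC/Theorems/DefiniteXiFreyModularityStubThreeImpTwoOfFacts.lean`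
(`--supports stmt-ABC-11340 --as helper`; rename the namespace to `Summit.ABC.ABC.Theorems`).

Leaves (named facts, hypotheses — never restated): `eichlerShimuraConstruction` / its first bullet
`WeakES`; `Carayol1986_artinConductorExponent`; Saito's `p = 2` half of Ogg's formula (all curves:
`SaitoTwoAll`; finest open residual: `SaitoTwoSupersingularResidual`).  Proved inputs by name:
`isModular_of_isModularGaloisRepTate_of_three_facts`, `isIsogenous_iff_frobeniusTrace_eq_holds`
(Faltings), `exists_rational_isNewform0_of_isModularGaloisRepTate'`,
`IsNewformOf.forall_level_eq_conductorNorm_of_carayol1986_of_saito`,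
`IsNewformOf.level_eq_conductorNorm_of_carayol1986_of_forall_not_hasAdditiveReductionAt_two`,
`IsNewformOf.level_eq_conductorNorm_of_squarefree` (Atkin–Lehner), `stub_nineTransfer_torsion`
(Silverberg's transfer).

* H13 — a SEMISTABLE curve needs `WeakES` only (no Carayol, no Saito): call sites I1/I3 on
  normalised Frey pairs;
* H14 — the switched curve `W'` of call site I2 on a pair with `4 ∤ N_E` needs `WeakES` +
  Carayol (A) only (Saito-free);
* H15 — squarefreeness of the conductor transfers along `E[ℓ] ≅ W'[ℓ]` (`ℓ ≥ 5`) up to the prime `ℓ`;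
* H16 — after a switch that also gives `25 ∤ N_{W'}` (the lead-level reshape S3⁺ of `stub_switch`),
  call site I2 needs `WeakES` only.

[cite: SilverbergCSS1997, Prop. 7.1] [cite: AtkinLehner1970, Thm. 3] [cite: DiamondShurman2005, Thm. 8.8.1]
[cite: SilvermanATAEC1994, Thm. IV.10.2]
-/

-- `Summit.ABC.ABC` is the mandated summit-side namespace for the single-conjunct summit `ABC`.
set_option linter.dupNamespace false

noncomputable section

open scoped NumberField MatrixGroups ModularForm
open NumberField IsDedekindDomain CongruenceSubgroup
open Literature.NumberTheory.EllipticCurves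
open Literature.NumberTheory.EllipticCurves.ModularForms
open Literature.NumberTheory.Automorphic
open Literature.NumberTheory.Automorphic.BCDT
open Literature.NumberTheory.GaloisRepresentations
open Literature.NumberTheory.DiophantineGeometry
open Field (absoluteGaloisGroup)
open WeierstrassCurve
open Summit.ABC.ABC.Theorems

namespace Summit.ABC.ABC.Cruxes.FreyModularity.Sketch.StubIdeasThreeImpTwo1G16

/-! # Part A (gen 9): currencies and H1–H9 -/

/-! ## §0 Currencies -/

/-- The registered stub's type, character for character (`Lines/Sketch.lean` :186). -/
def SigS9 : Prop :=
  ∀ (W : WeierstrassCurve ℚ) [W.IsElliptic] [NeZero (W.conductorNorm ℤ)] (ℓ : ℕ) [Fact ℓ.Prime],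
    W.IsModularGaloisRepTate ℓ → BCDT.IsModular W

example : SigS9 = (∀ (W : WeierstrassCurve ℚ) [W.IsElliptic] [NeZero (W.conductorNorm ℤ)] (ℓ : ℕ)
    [Fact ℓ.Prime], W.IsModularGaloisRepTate ℓ → BCDT.IsModular W) := rfl

/-- `hC`, the second binder of the skeleton closer `stub_threeImpTwo_of_two_facts` (:584), verbatim. -/
def CarayolLevel : Prop :=
  ∀ (N : ℕ) [NeZero N], IsNewformOf.level_eq_conductorNorm (N := N)

/-- Saito's `p = 2` half of Ogg's formula for every curve over `ℚ` and every `ℓ` — verbatim the binder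
`hS` of the tree theorem `IsNewformOf.forall_level_eq_conductorNorm_of_carayol1986_of_saito`. -/
def SaitoTwoAll : Prop :=
  ∀ (V : WeierstrassCurve ℚ) (ℓ : ℕ) [Fact ℓ.Prime],
    V.swanConductorAt_rationalTate_eq_wildConductorExponent_of_ringChar_eq_two ℓ

/-- The same at the single prime `ℓ = 3` (the `3`-adic Tate module above `2`). -/
def SaitoTwoAtThree : Prop :=
  ∀ (V : WeierstrassCurve ℚ), V.swanConductorAt_rationalTate_eq_wildConductorExponent_of_ringChar_eq_two 3

attribute [local instance] AddSubgroup.torsionBy.zmodModule in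
/-- The finest residual of Saito's theorem over `ℚ` the tree leaves open (hypothesis `H` of
`swanConductorAt_rationalTate_eq_wildConductorExponent_of_ringChar_eq_two_of_valuation_j_lt_one`,
`OggFormulaPotGoodOrdinaryTwoProofs` :982, quantified over the curve): additive, potentially good
reduction at `2` with `|j|₂ < 1` (supersingular special fibre), in `3`-torsion form. -/
def SaitoTwoSupersingularResidual : Prop :=
  ∀ (V : WeierstrassCurve ℚ) [V.IsElliptic],
    V.HasAdditiveReductionAt ((Rat.HeightOneSpectrum.primesEquiv (R := 𝓞 ℚ)).symm ⟨2, Nat.prime_two⟩) →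
    ((Rat.HeightOneSpectrum.primesEquiv (R := 𝓞 ℚ)).symm ⟨2, Nat.prime_two⟩).valuation ℚ V.j < 1 →
    ∃ 𝔓 ∈ ((Rat.HeightOneSpectrum.primesEquiv (R := 𝓞 ℚ)).symm ⟨2, Nat.prime_two⟩).primesAbove,
      (V.torsionGaloisRep 3).swanConductorAt (𝓞 ℚ) 𝔓 =
        (V.wildConductorExponent
          ((Rat.HeightOneSpectrum.primesEquiv (R := 𝓞 ℚ)).symm ⟨2, Nat.prime_two⟩) : ℝ)

/-- The first bullet of `eichlerShimuraConstruction` alone — exactly what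
`isModular_of_isModularGaloisRepTate_of_facts` consumes (`obtain ⟨W', hW', hW'f, -⟩ := hES hf hint`);
the period-lattice clause is never used on the (3) ⇒ (2) road. -/
def WeakES : Prop :=
  ∀ {N : ℕ} [NeZero N] {f : CuspForm (Gamma0 N) 2}, IsNewform0 f →
    (∀ n : ℕ, ∃ a : ℤ, cuspCoeff f n = a) →
    ∃ (W : WeierstrassCurve ℚ) (_ : W.IsElliptic), IsNewformOf W f

/-! ## §1 Plan A — by name, zero transcription -/

/-- **H1 (XS, PROVED).** Saito's half at every `ℓ` from its `ℓ = 3` instance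
(`…_of_ringChar_eq_two_of_three`, Silverman ATAEC IV.10.2(c)). -/
theorem saitoTwoAll_of_atThree (h : SaitoTwoAtThree) : SaitoTwoAll :=
  fun V ℓ _ ↦ V.swanConductorAt_rationalTate_eq_wildConductorExponent_of_ringChar_eq_two_of_three ℓ (h V)

attribute [local instance] AddSubgroup.torsionBy.zmodModule in
/-- **H2 (XS, PROVED).** Saito's half for all curves over `ℚ` from the supersingular corner
(`…_of_ringChar_eq_two_of_valuation_j_lt_one`: `|j|₂ ≥ 1` and `|j|₂ > 1`… are theorems of the tree). -/
theorem saitoTwoAll_of_residual (H : SaitoTwoSupersingularResidual) : SaitoTwoAll :=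
  fun V ℓ _ ↦
    V.swanConductorAt_rationalTate_eq_wildConductorExponent_of_ringChar_eq_two_of_valuation_j_lt_one ℓ
      (H V)

/-- **H3 (XS, PROVED).** The skeleton closer's binder `hC` from Carayol (A) + Saito-at-2
(the tree's 2026-08-28 theorem, by name). -/
theorem carayolLevel_of_carayol1986_of_saito (hCA : Carayol1986_artinConductorExponent)
    (hS : SaitoTwoAll) : CarayolLevel :=
  IsNewformOf.forall_level_eq_conductorNorm_of_carayol1986_of_saito hCA hS

/-- **H4 (XS, PROVED).** The verbatim stub from {`eichlerShimuraConstruction`,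
`Carayol1986_artinConductorExponent`, Saito-at-2 ∀ curves} — the skeleton's own closer
`stub_threeImpTwo_of_two_facts` with `hC` discharged. -/
theorem sigS9_of_ES_of_carayol1986_of_saito (hES : eichlerShimuraConstruction)
    (hCA : Carayol1986_artinConductorExponent) (hS : SaitoTwoAll) : SigS9 :=
  fun W _ _ ℓ _ h ↦
    isModular_of_isModularGaloisRepTate_of_three_facts hES isIsogenous_iff_frobeniusTrace_eq_holds
      (carayolLevel_of_carayol1986_of_saito hCA hS) W ℓ h

/-- **Gen-9 closer (PROVED): the stub, typed LITERALLY as the skeleton states it, from the three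
catalogued named facts, Saito's entering only through its open supersingular corner.**
(`isModular_of_isModularGaloisRepTate_of_three_facts hES isIsogenous_iff_frobeniusTrace_eq_holds` is
definitionally the skeleton's `stub_threeImpTwo_of_two_facts hES` / the tree's `_of_two_facts`.) -/
theorem stub_threeImpTwo_of_ES_of_carayol1986_of_saitoResidual (hES : eichlerShimuraConstruction)
    (hCA : Carayol1986_artinConductorExponent) (H : SaitoTwoSupersingularResidual) :
    ∀ (W : WeierstrassCurve ℚ) [W.IsElliptic] [NeZero (W.conductorNorm ℤ)] (ℓ : ℕ) [Fact ℓ.Prime],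
      W.IsModularGaloisRepTate ℓ → BCDT.IsModular W :=
  sigS9_of_ES_of_carayol1986_of_saito hES hCA (saitoTwoAll_of_residual H)

/-- The same with Saito's half at the single prime `3` (H1). -/
theorem stub_threeImpTwo_of_ES_of_carayol1986_of_saitoThree (hES : eichlerShimuraConstruction)
    (hCA : Carayol1986_artinConductorExponent) (h3 : SaitoTwoAtThree) :
    ∀ (W : WeierstrassCurve ℚ) [W.IsElliptic] [NeZero (W.conductorNorm ℤ)] (ℓ : ℕ) [Fact ℓ.Prime],
      W.IsModularGaloisRepTate ℓ → BCDT.IsModular W :=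
  sigS9_of_ES_of_carayol1986_of_saito hES hCA (saitoTwoAll_of_atThree h3)

/-! ## §2 Plan B — pointwise (one curve), level = conductor for THAT curve only -/

/-- **H5 (XS, PROVED).** `eichlerShimuraConstruction → WeakES` (drop the lattice clause). -/
theorem weakES_of_ES (hES : eichlerShimuraConstruction) : WeakES := by
  intro N _ f hf hint
  obtain ⟨W, hW, hWf, -⟩ := hES hf hint
  exact ⟨W, hW, hWf⟩

/-- **H6 (S, PROVED): pointwise (3) ⇒ (2).**  For ONE elliptic `W/ℚ`: if every newform of `W` (at any
level) has level `N_W` — `hCW`, level = conductor FOR THIS CURVE — then `ρ_{W,ℓ}` modular ⇒ `W`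
modular, granted `WeakES` only.  Proof = `isModular_of_isModularGaloisRepTate_of_facts`
(CDTTheorem722Proofs :674–700) with `hL`, `hF` discharged by the tree
(`exists_rational_isNewform0_of_isModularGaloisRepTate'`, `isIsogenous_iff_frobeniusTrace_eq_holds`)
and `hC N hWf` replaced by `hCW hWf`. -/
theorem isModular_of_isModularGaloisRepTate_of_weakES_of_levelEq (hES₁ : WeakES)
    (W : WeierstrassCurve ℚ) [W.IsElliptic] [NeZero (W.conductorNorm ℤ)]
    (hCW : ∀ {N : ℕ} [NeZero N] {f : CuspForm (Gamma0 N) 2}, IsNewformOf W f → N = W.conductorNorm ℤ)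
    (ℓ : ℕ) [Fact ℓ.Prime] (h : W.IsModularGaloisRepTate ℓ) : BCDT.IsModular W := by
  classical
  have hℓp : ℓ.Prime := Fact.out
  obtain ⟨N, hN, f, hf, hint, hcoeff⟩ := exists_rational_isNewform0_of_isModularGaloisRepTate' W ℓ h
  haveI : NeZero (N * (ℓ * W.conductorNorm ℤ)) :=
    ⟨mul_ne_zero (NeZero.ne N) (mul_ne_zero hℓp.ne_zero (NeZero.ne _))⟩
  obtain ⟨W', hW', hW'f⟩ := hES₁ hf hint
  have hiso : IsIsogenous W W' := by
    refine WeierstrassCurve.isIsogenous_of_finite_setOf_LFunction_ne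
      isIsogenous_iff_frobeniusTrace_eq_holds W W' ?_
    refine (N * (ℓ * W.conductorNorm ℤ)).primeFactors.finite_toSet.subset ?_
    rintro p ⟨hp, hne⟩
    refine (Nat.mem_primeFactors_of_ne_zero (NeZero.ne _)).mpr ⟨hp, ?_⟩
    by_contra hpM
    exact hne (by exact_mod_cast (hcoeff p hp hpM).symm.trans (hW'f.2 p))
  have hWf : IsNewformOf W f := ⟨hf, fun n ↦ by rw [hW'f.2 n, hiso.LFunction_eq]⟩
  have hNE : N = W.conductorNorm ℤ := hCW hWf
  subst hNE
  exact ⟨f, hWf⟩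

/-- **H7 (XS, PROVED): pointwise closer with Saito FOR THE CURVE AT HAND at the single prime `3`**
(Carayol (A) for level = conductor at odd places and at a non-additive `2`; Saito only if `W` is
additive at `2`).  This is the form k2's route-minimal recut consumes: on Frey curves the `ℓ = 3`
Saito instance is LANDED (`Summit.ABC.ABC.Theorems.swanConductorAt_torsion_three_freyCurve_of_two_mul`
via k2 g6 :1696). -/
theorem isModular_of_isModularGaloisRepTate_pointwise (hES₁ : WeakES)
    (hCA : Carayol1986_artinConductorExponent) (W : WeierstrassCurve ℚ) [W.IsElliptic]
    [NeZero (W.conductorNorm ℤ)]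
    (hS3 : W.swanConductorAt_rationalTate_eq_wildConductorExponent_of_ringChar_eq_two 3)
    (ℓ : ℕ) [Fact ℓ.Prime] (h : W.IsModularGaloisRepTate ℓ) : BCDT.IsModular W :=
  isModular_of_isModularGaloisRepTate_of_weakES_of_levelEq hES₁ W
    (fun hWf ↦ IsNewformOf.level_eq_conductorNorm_of_carayol1986_of_saito hCA
      (fun ℓ' _ ↦ W.swanConductorAt_rationalTate_eq_wildConductorExponent_of_ringChar_eq_two_of_three
        ℓ' hS3) hWf) ℓ h

/-- **H8 (XS, PROVED): Saito-free pointwise closer for curves with no additive place of residue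
characteristic `2`** (Carayol (A) alone: `…_of_forall_not_hasAdditiveReductionAt_two`). -/
theorem isModular_of_isModularGaloisRepTate_pointwise_of_not_additive_two (hES₁ : WeakES)
    (hCA : Carayol1986_artinConductorExponent) (W : WeierstrassCurve ℚ) [W.IsElliptic]
    [NeZero (W.conductorNorm ℤ)]
    (h2 : ∀ w : HeightOneSpectrum (𝓞 ℚ), ringChar (𝓞 ℚ ⧸ w.asIdeal) = 2 → ¬ W.HasAdditiveReductionAt w)
    (ℓ : ℕ) [Fact ℓ.Prime] (h : W.IsModularGaloisRepTate ℓ) : BCDT.IsModular W :=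
  isModular_of_isModularGaloisRepTate_of_weakES_of_levelEq hES₁ W
    (fun hWf ↦
      IsNewformOf.level_eq_conductorNorm_of_carayol1986_of_forall_not_hasAdditiveReductionAt_two hCA
        hWf h2) ℓ h

/-- **H9 (XS, PROVED): the verbatim stub from `WeakES` + Carayol (A) + Saito at `ℓ = 3` ∀ curves**
(Plan B's ∀-closure = Plan A with `eichlerShimuraConstruction` weakened to its first bullet). -/
theorem stub_threeImpTwo_of_weakES_of_carayol1986_of_saitoThree (hES₁ : WeakES)
    (hCA : Carayol1986_artinConductorExponent) (h3 : SaitoTwoAtThree) :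
    ∀ (W : WeierstrassCurve ℚ) [W.IsElliptic] [NeZero (W.conductorNorm ℤ)] (ℓ : ℕ) [Fact ℓ.Prime],
      W.IsModularGaloisRepTate ℓ → BCDT.IsModular W :=
  fun W _ _ ℓ _ h ↦ isModular_of_isModularGaloisRepTate_pointwise hES₁ hCA W (h3 W) ℓ h

/-! # Part B (gen 15): Silverberg's transfer at every `p ≠ ℓ` (H10–H12) -/


/-- **Semistability at `p ≠ ℓ` transfers along a common framed model of the `ℓ`-torsion**
(`ℓ ≥ 5`): if `E[ℓ] ≅ E'[ℓ]` as `Γ_ℚ`-modules and `p² ∤ N_E` then `p² ∤ N_{E'}`.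
Proof as `stub_nineTransfer`: `E` is good or multiplicative at `p`, so `I_p` fixes a non-zero
`ℓ`-torsion point of `E`, hence of `E'`; if `E'` were additive at `p`, `E'[ℓ]^{I_p} = 0`
(`stub_nineTransfer_torsion`, `c_p(E') ≤ 4 < ℓ`). [cite: SilverbergCSS1997, Prop. 7.1] -/
theorem not_sq_dvd_conductorNorm_of_isTorsionGaloisRep
    (W W' : WeierstrassCurve ℚ) [W.IsElliptic] [W'.IsElliptic] {ℓ : ℕ} [Fact ℓ.Prime] (hℓ4 : 4 < ℓ)
    (ρ : ModPGaloisRep ℚ (ZMod ℓ) 2) (hρ : W.IsTorsionGaloisRep ℓ ρ) (hρ' : W'.IsTorsionGaloisRep ℓ ρ)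
    {p : ℕ} (hp : p.Prime) (hpℓ : p ≠ ℓ) (hW2 : ¬ p ^ 2 ∣ W.conductorNorm ℤ) :
    ¬ p ^ 2 ∣ W'.conductorNorm ℤ := by
  intro hW'2
  classical
  have hℓp : ℓ.Prime := Fact.out
  set v : HeightOneSpectrum (𝓞 ℚ) :=
    (Rat.HeightOneSpectrum.primesEquiv (R := 𝓞 ℚ)).symm ⟨p, hp⟩ with hv
  have hvp : (Rat.HeightOneSpectrum.primesEquiv v : ℕ) = p := by rw [hv, Equiv.apply_symm_apply]
  have hℓv : ((ℓ : ℕ) : 𝓞 ℚ) ∉ v.asIdeal := by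
    rw [natCast_mem_asIdeal_iff_eq_primesEquiv_symm v hℓp, hv,
      (Rat.HeightOneSpectrum.primesEquiv (R := 𝓞 ℚ)).symm.injective.eq_iff]
    intro h
    exact hpℓ (congrArg Subtype.val h)
  obtain ⟨𝔓, h𝔓⟩ := HeightOneSpectrum.primesAbove_nonempty v
  have hW : ¬ W.HasAdditiveReductionAt v := by
    rw [← sq_dvd_conductorNorm_iff_hasAdditiveReductionAt W hp hvp]
    exact hW2
  have hW' : W'.HasAdditiveReductionAt v := by
    rw [← sq_dvd_conductorNorm_iff_hasAdditiveReductionAt W' hp hvp]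
    exact hW'2
  obtain ⟨P₀, hP₀0, hP₀ℓ, hP₀fix⟩ :=
    exists_ne_zero_smul_eq_of_not_hasAdditiveReductionAt W ℓ hℓv hW h𝔓
  set P : geomTorsion W ((ℓ : ℕ) : ℤ) := ⟨P₀, AddSubgroup.torsionBy.nsmul_iff.mpr hP₀ℓ⟩ with hPdef
  obtain ⟨P', hP'0, hP'fix⟩ := exists_torsion_of_isTorsionGaloisRep hρ hρ' P
  have hPfix : ∀ σ ∈ 𝔓.inertia (absoluteGaloisGroup ℚ), σ • P = P := fun σ hσ ↦
    Subtype.ext (by rw [AddSubgroup.torsionBy.coe_smul]; exact hP₀fix σ hσ)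
  have hP'ℓ : ℓ • (P' : geomPoints W') = 0 := AddSubgroup.torsionBy.nsmul_iff.mp P'.2
  have hP'zero : (P' : geomPoints W') = 0 :=
    stub_nineTransfer_torsion W' hℓp hℓ4 hℓv hW' h𝔓 (P' : geomPoints W') hP'ℓ
      (fun σ hσ ↦ by rw [← AddSubgroup.torsionBy.coe_smul, hP'fix σ (hPfix σ hσ)])
  have hP'eq : P' = 0 := Subtype.ext hP'zero
  have hPeq : P = 0 := hP'0.mp hP'eq
  exact hP₀0 (congrArg Subtype.val hPeq)

/-- **H10 `fourTransfer`** — the `p = 2` twin of the closed stub `stub_nineTransfer`: along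
`E[5] ≅ E'[5]`, `4 ∤ N_E ⇒ 4 ∤ N_{E'}`. [cite: SilverbergCSS1997, Prop. 7.1] -/
theorem fourTransfer :
    ∀ (W W' : WeierstrassCurve ℚ) [W.IsElliptic] [W'.IsElliptic] (ρ : ModPGaloisRep ℚ (ZMod 5) 2),
      W.IsTorsionGaloisRep 5 ρ → W'.IsTorsionGaloisRep 5 ρ →
      ¬ 4 ∣ W.conductorNorm ℤ → ¬ 4 ∣ W'.conductorNorm ℤ := by
  intro W W' _ _ ρ hρ hρ' h4
  haveI : Fact (Nat.Prime 5) := ⟨Nat.prime_five⟩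
  have h := not_sq_dvd_conductorNorm_of_isTorsionGaloisRep W W' (ℓ := 5) (by norm_num) ρ hρ hρ'
    Nat.prime_two (by norm_num) (by simpa using h4)
  simpa using h

/-- Sanity: the tree's `stub_nineTransfer` is the case `p = 3`, `ℓ = 5`. [folklore] -/
theorem nineTransfer' :
    ∀ (W W' : WeierstrassCurve ℚ) [W.IsElliptic] [W'.IsElliptic] (ρ : ModPGaloisRep ℚ (ZMod 5) 2),
      W.IsTorsionGaloisRep 5 ρ → W'.IsTorsionGaloisRep 5 ρ →
      ¬ 9 ∣ W.conductorNorm ℤ → ¬ 9 ∣ W'.conductorNorm ℤ := by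
  intro W W' _ _ ρ hρ hρ' h9
  haveI : Fact (Nat.Prime 5) := ⟨Nat.prime_five⟩
  have h := not_sq_dvd_conductorNorm_of_isTorsionGaloisRep W W' (ℓ := 5) (by norm_num) ρ hρ hρ'
    Nat.prime_three (by norm_num) (by simpa using h9)
  simpa using h

/-- **Squarefree-away-from-`ℓ` transfer**: if `E[ℓ] ≅ E'[ℓ]` (`ℓ ≥ 5`) and `N_E` is not divisible
by `p²` for any prime `p ≠ ℓ`, the same holds for `N_{E'}` — semistability away from `ℓ` is read
off from `E[ℓ]`. [cite: SilverbergCSS1997, Prop. 7.1] -/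
theorem forall_not_sq_dvd_conductorNorm_of_isTorsionGaloisRep
    (W W' : WeierstrassCurve ℚ) [W.IsElliptic] [W'.IsElliptic] {ℓ : ℕ} [Fact ℓ.Prime] (hℓ4 : 4 < ℓ)
    (ρ : ModPGaloisRep ℚ (ZMod ℓ) 2) (hρ : W.IsTorsionGaloisRep ℓ ρ) (hρ' : W'.IsTorsionGaloisRep ℓ ρ)
    (h : ∀ p : ℕ, p.Prime → p ≠ ℓ → ¬ p ^ 2 ∣ W.conductorNorm ℤ) :
    ∀ p : ℕ, p.Prime → p ≠ ℓ → ¬ p ^ 2 ∣ W'.conductorNorm ℤ :=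
  fun p hp hpℓ ↦ not_sq_dvd_conductorNorm_of_isTorsionGaloisRep W W' hℓ4 ρ hρ hρ' hp hpℓ (h p hp hpℓ)

/-! ## H11: `4 ∤ N_E` ⇒ no additive reduction above `2` (the hypothesis `h2` of the pointwise,
Saito-free level-`=`-conductor theorem
`IsNewformOf.level_eq_conductorNorm_of_carayol_of_forall_not_hasAdditiveReductionAt_two`) -/

/-- **H11.** If `4 ∤ N_E` then `E` is not of additive reduction at any place of residue
characteristic `2` (`2² ∣ N_E ⟺` additive at the place over `2`,
`sq_dvd_conductorNorm_iff_hasAdditiveReductionAt`). [cite: SilvermanATAEC1994, Thm. IV.10.2(a)] -/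
theorem forall_not_hasAdditiveReductionAt_of_not_four_dvd (W : WeierstrassCurve ℚ) [W.IsElliptic]
    (h4 : ¬ 4 ∣ W.conductorNorm ℤ) :
    ∀ w : HeightOneSpectrum (𝓞 ℚ), ringChar (𝓞 ℚ ⧸ w.asIdeal) = 2 → ¬ W.HasAdditiveReductionAt w := by
  intro w h2 hadd
  classical
  have h20 : ((2 : ℕ) : 𝓞 ℚ ⧸ w.asIdeal) = 0 := by rw [ringChar.spec, h2]
  have hmem : ((2 : ℕ) : 𝓞 ℚ) ∈ w.asIdeal := by
    rw [← Ideal.Quotient.eq_zero_iff_mem, map_natCast]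
    exact h20
  rw [natCast_mem_asIdeal_iff_eq_primesEquiv_symm w Nat.prime_two] at hmem
  have hw2 : (Rat.HeightOneSpectrum.primesEquiv w : ℕ) = 2 := by
    rw [hmem, Equiv.apply_symm_apply]
  have h := (sq_dvd_conductorNorm_iff_hasAdditiveReductionAt W Nat.prime_two hw2).mpr hadd
  exact h4 (by simpa using h)

/-- **Call site I2 (the switched curve).** Along `E[5] ≅ W'[5]`, `4 ∤ N_E` makes `W'` free of
additive reduction above `2` — the hypothesis `h2` of the Saito-free pointwise closer H8
(`isModular_of_isModularGaloisRepTate_pointwise_of_not_additive_two`, companion `…_1g9.lean`).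
[cite: SilverbergCSS1997, Prop. 7.1] -/
theorem forall_not_hasAdditiveReductionAt_two_of_isTorsionGaloisRep_five
    (W W' : WeierstrassCurve ℚ) [W.IsElliptic] [W'.IsElliptic] (ρ : ModPGaloisRep ℚ (ZMod 5) 2)
    (hρ : W.IsTorsionGaloisRep 5 ρ) (hρ' : W'.IsTorsionGaloisRep 5 ρ) (h4 : ¬ 4 ∣ W.conductorNorm ℤ) :
    ∀ w : HeightOneSpectrum (𝓞 ℚ), ringChar (𝓞 ℚ ⧸ w.asIdeal) = 2 → ¬ W'.HasAdditiveReductionAt w :=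
  forall_not_hasAdditiveReductionAt_of_not_four_dvd W' (fourTransfer W W' ρ hρ hρ' h4)

/-! # Part C (gen 16): the per-call-site residue of S9 (H13–H16) -/

/-- **H13 (XS, PROVED): (3) ⇒ (2) for a SEMISTABLE curve from `WeakES` alone.**  Level = conductor
for a curve with squarefree conductor is the tree's `IsNewformOf.level_eq_conductorNorm_of_squarefree`
(Atkin–Lehner `q`-expansion arithmetic — no Carayol, no Saito); feed it to the pointwise closer H6.
Covers call sites I1/I3 on normalised Frey pairs (`N_E` squarefree).
[cite: AtkinLehner1970, Thm. 3] [cite: DiamondShurman2005, Thm. 8.8.1] -/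
theorem isModular_of_isModularGaloisRepTate_of_weakES_of_squarefree (hES₁ : WeakES)
    (W : WeierstrassCurve ℚ) [W.IsElliptic] [NeZero (W.conductorNorm ℤ)]
    (hsq : Squarefree (W.conductorNorm ℤ)) (ℓ : ℕ) [Fact ℓ.Prime]
    (h : W.IsModularGaloisRepTate ℓ) : BCDT.IsModular W :=
  isModular_of_isModularGaloisRepTate_of_weakES_of_levelEq hES₁ W
    (fun hf ↦ hf.level_eq_conductorNorm_of_squarefree hsq) ℓ h

/-- **H14 (XS, PROVED): call site I2 on a pair with `4 ∤ N_E` is Saito-free.**  Along `E[5] ≅ W'[5]`,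
`4 ∤ N_E` makes `W'` non-additive above `2` (H12), so the Saito-free pointwise closer H8 applies:
`WeakES` + Carayol (A), the latter needed only at the odd additive primes of `W'` (for the verbatim
switch: at most `p = 5`, by H15). [cite: SilverbergCSS1997, Prop. 7.1] -/
theorem isModular_switch_of_weakES_of_carayol1986_of_not_four_dvd (hES₁ : WeakES)
    (hCA : Carayol1986_artinConductorExponent)
    (W W' : WeierstrassCurve ℚ) [W.IsElliptic] [W'.IsElliptic] [NeZero (W'.conductorNorm ℤ)]
    (ρ : ModPGaloisRep ℚ (ZMod 5) 2) (hρ : W.IsTorsionGaloisRep 5 ρ) (hρ' : W'.IsTorsionGaloisRep 5 ρ)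
    (h4 : ¬ 4 ∣ W.conductorNorm ℤ) (ℓ : ℕ) [Fact ℓ.Prime] (h : W'.IsModularGaloisRepTate ℓ) :
    BCDT.IsModular W' :=
  isModular_of_isModularGaloisRepTate_pointwise_of_not_additive_two hES₁ hCA W'
    (forall_not_hasAdditiveReductionAt_two_of_isTorsionGaloisRep_five W W' ρ hρ hρ' h4) ℓ h

/-- **H15 (XS, PROVED): squarefreeness of the conductor transfers along `E[ℓ] ≅ W'[ℓ]` up to `ℓ`.**
If `N_E` is squarefree, `E[ℓ] ≅ W'[ℓ]` with `ℓ ≥ 5`, and `ℓ² ∤ N_{W'}`, then `N_{W'}` is squarefree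
(H10 at every prime `p ≠ ℓ`).  The hypothesis at `ℓ` cannot be dropped: at `ℓ = p = 5` a semistable
ordinary curve and an additive potentially-good curve with `e = 4` have the same tame inertia
signature `{1, ω}` on the `5`-torsion. [cite: SilverbergCSS1997, Prop. 7.1] -/
theorem squarefree_conductorNorm_of_isTorsionGaloisRep
    (W W' : WeierstrassCurve ℚ) [W.IsElliptic] [W'.IsElliptic] {ℓ : ℕ} [Fact ℓ.Prime] (hℓ4 : 4 < ℓ)
    (ρ : ModPGaloisRep ℚ (ZMod ℓ) 2) (hρ : W.IsTorsionGaloisRep ℓ ρ) (hρ' : W'.IsTorsionGaloisRep ℓ ρ)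
    (hsq : Squarefree (W.conductorNorm ℤ)) (hℓ2 : ¬ ℓ ^ 2 ∣ W'.conductorNorm ℤ) :
    Squarefree (W'.conductorNorm ℤ) := by
  rw [Nat.squarefree_iff_prime_squarefree]
  intro p hp hp2
  by_cases hpℓ : p = ℓ
  · subst hpℓ
    exact hℓ2 (by rwa [sq])
  · exact not_sq_dvd_conductorNorm_of_isTorsionGaloisRep W W' hℓ4 ρ hρ hρ' hp hpℓ
      (fun hW ↦ (Nat.squarefree_iff_prime_squarefree.mp hsq) p hp (by rwa [sq] at hW)) (by rwa [sq])

/-- **H16 (XS, PROVED): call site I2 after a switch that also controls `W'` at `5` needs `WeakES`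
only.**  On a normalised pair (`N_E` squarefree) a switched curve with `E[5] ≅ W'[5]` and
`25 ∤ N_{W'}` is semistable (H15), so H13 closes it.  `25 ∤ N_{W'}` is what a `5`-adically close
member of Rubin's twist family supplies (CSS 1997, p. 560, with Lemma 12: the exceptional `t`-set is
finite) — a reshape of `stub_switch`, not of this stub.
[cite: SilverbergCSS1997, Prop. 7.1] [cite: AtkinLehner1970, Thm. 3] -/
theorem isModular_switch_of_weakES_of_squarefree_of_not_twentyFive_dvd (hES₁ : WeakES)
    (W W' : WeierstrassCurve ℚ) [W.IsElliptic] [W'.IsElliptic] [NeZero (W'.conductorNorm ℤ)]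
    (ρ : ModPGaloisRep ℚ (ZMod 5) 2) (hρ : W.IsTorsionGaloisRep 5 ρ) (hρ' : W'.IsTorsionGaloisRep 5 ρ)
    (hsq : Squarefree (W.conductorNorm ℤ)) (h25 : ¬ 25 ∣ W'.conductorNorm ℤ)
    (ℓ : ℕ) [Fact ℓ.Prime] (h : W'.IsModularGaloisRepTate ℓ) : BCDT.IsModular W' := by
  haveI : Fact (Nat.Prime 5) := ⟨Nat.prime_five⟩
  exact isModular_of_isModularGaloisRepTate_of_weakES_of_squarefree hES₁ W'
    (squarefree_conductorNorm_of_isTorsionGaloisRep W W' (ℓ := 5) (by norm_num) ρ hρ hρ' hsq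
      (by simpa using h25)) ℓ h

/-! # Assembly checks (kernel-checked; the verbatim stub type is `SigS9`) -/

/-- Plan A: the verbatim stub from the three leaves, Saito entering through its open corner only. -/
example (hES : eichlerShimuraConstruction) (hCA : Carayol1986_artinConductorExponent)
    (H : SaitoTwoSupersingularResidual) : SigS9 :=
  stub_threeImpTwo_of_ES_of_carayol1986_of_saitoResidual hES hCA H

/-- Plan B: the verbatim stub from `WeakES` + Carayol (A) + Saito at the single prime `3`. -/
example (hES₁ : WeakES) (hCA : Carayol1986_artinConductorExponent) (h3 : SaitoTwoAtThree) : SigS9 :=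
  stub_threeImpTwo_of_weakES_of_carayol1986_of_saitoThree hES₁ hCA h3

end Summit.ABC.ABC.Cruxes.FreyModularity.Sketch.StubIdeasThreeImpTwo1G16

end
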